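import Literature.NumberTheory.EllipticCurves.Greenberg1999.TwoTorsionMuInvariant
import Literature.NumberTheory.DiophantineGeometry.Conductor
import HarnessLib

/-!
# The elliptic curves of conductor `17` (Cremona's Table 1: the isogeny class 17a)

J. E. Cremona's tables list, for every conductor `N ≤ 1000`, all MODULAR elliptic curves over `ℚ` of conductor
`N` up to `ℚ`-isomorphism (computed from the modular symbols of level `N`); by the modularity of semistable
elliptic curves (Wiles 1995; for squarefree `N` such as `17` every curve of conductor `N` is semistable) the
list is the complete list of elliptic curves of that conductor. At `N = 17` (the smallest conductor with a
rational point of order `2`; `X₀(17)` itself is `17a1`) the table has ONE isogeny class of FOUR curves: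

* `17a1 = [1, −1, 1, −1, −14]` (`Δ = −17⁴`), `17a2 = [1, −1, 1, −6, −4]` (`Δ = 17²`, full rational `2`-torsion),
  `17a3 = [1, −1, 1, −91, −310]` (`Δ = 17`), `17a4 = [1, −1, 1, −1, 0]` (`Δ = 17`).

This file records
* the four models `cremona17a1 … cremona17a4` (definitions) with their discriminants (proved) and a rational
  point of order `2` on each (proved: `x = 11/4`, `−1`, `−21/4`, `1`);
* `Cremona1997_conductor_seventeen_classification` — «every elliptic curve over `ℚ` of conductor `17` is
  `ℚ`-isomorphic to one of 17a1–17a4», a NAMED FACT (the modular-symbol computation at level `17` and the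
  modularity theorem are not in the tree). Consumer: the prime-level content of the crux E1M line `star`
  (`Summits/…/Theorems/EisensteinDepletionAtTwoStarPrimeLevelSeventeen.lean`, hypothesis `h17`), next to
  Setzer's classification `Setzer1975_primeConductor_rationalTwoTorsion` (`NeumannSetzerCurves.lean`), which
  leaves exactly the conductor `17` aside.

## References
* J. E. Cremona, *Algorithms for Modular Elliptic Curves*, 2nd ed., Cambridge University Press (1997), Table 1
  (N = 17: curves 17a1–17a4). [CremonaAlgorithms1997]
* A. Wiles, *Modular elliptic curves and Fermat's Last Theorem*, Ann. of Math. 141 (1995), 443–551, Thm. 0.4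
  (semistable modularity). [Wiles1995]
* B. Mazur, *Modular curves and the Eisenstein ideal*, Publ. Math. IHÉS 47 (1977), III §7 (p. 162): prime conductor
  and a rational point of order `2` ⇒ `N = 17` and isogenous to `X₀(17)`, or Neumann–Setzer. Held text
  `paper:doi-10-1007-bf02684339` (PDF p. 131). [Mazur1977]
* B. Setzer, *Elliptic curves of prime conductor*, J. London Math. Soc. (2) 10 (1975), 367–378 (conductor 17
  is the exceptional prime). [Setzer1975]
-/

set_option autoImplicit false

noncomputable section

namespace Literature.NumberTheory.EllipticCurves

open Greenberg1999

/-- **Cremona's curve 17a1** `= [1, −1, 1, −1, −14]` (the modular curve `X₀(17)`).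
[cite: CremonaAlgorithms1997, Table 1 (N = 17, curve 17a1)] -/
def cremona17a1 : WeierstrassCurve ℚ := ⟨1, -1, 1, -1, -14⟩

/-- **Cremona's curve 17a2** `= [1, −1, 1, −6, −4]` (full rational `2`-torsion).
[cite: CremonaAlgorithms1997, Table 1 (N = 17, curve 17a2)] -/
def cremona17a2 : WeierstrassCurve ℚ := ⟨1, -1, 1, -6, -4⟩

/-- **Cremona's curve 17a3** `= [1, −1, 1, −91, −310]`. [cite: CremonaAlgorithms1997, Table 1 (N = 17, curve 17a3)] -/
def cremona17a3 : WeierstrassCurve ℚ := ⟨1, -1, 1, -91, -310⟩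

/-- **Cremona's curve 17a4** `= [1, −1, 1, −1, 0]`. [cite: CremonaAlgorithms1997, Table 1 (N = 17, curve 17a4)] -/
def cremona17a4 : WeierstrassCurve ℚ := ⟨1, -1, 1, -1, 0⟩

/-- `Δ(17a1) = −17⁴`. [cite: CremonaAlgorithms1997, Table 1 (N = 17)] -/
theorem Δ_cremona17a1 : cremona17a1.Δ = -(17 : ℚ) ^ 4 := by
  simp only [cremona17a1, WeierstrassCurve.Δ, WeierstrassCurve.b₂, WeierstrassCurve.b₄, WeierstrassCurve.b₆,
    WeierstrassCurve.b₈]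
  norm_num

/-- `Δ(17a2) = 17²`. [cite: CremonaAlgorithms1997, Table 1 (N = 17)] -/
theorem Δ_cremona17a2 : cremona17a2.Δ = (17 : ℚ) ^ 2 := by
  simp only [cremona17a2, WeierstrassCurve.Δ, WeierstrassCurve.b₂, WeierstrassCurve.b₄, WeierstrassCurve.b₆,
    WeierstrassCurve.b₈]
  norm_num

/-- `Δ(17a3) = 17`. [cite: CremonaAlgorithms1997, Table 1 (N = 17)] -/
theorem Δ_cremona17a3 : cremona17a3.Δ = 17 := by
  simp only [cremona17a3, WeierstrassCurve.Δ, WeierstrassCurve.b₂, WeierstrassCurve.b₄, WeierstrassCurve.b₆,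
    WeierstrassCurve.b₈]
  norm_num

/-- `Δ(17a4) = 17`. [cite: CremonaAlgorithms1997, Table 1 (N = 17)] -/
theorem Δ_cremona17a4 : cremona17a4.Δ = 17 := by
  simp only [cremona17a4, WeierstrassCurve.Δ, WeierstrassCurve.b₂, WeierstrassCurve.b₄, WeierstrassCurve.b₆,
    WeierstrassCurve.b₈]
  norm_num

/-- `17a1` has the rational point `(11/4, −15/8)` of order `2`. [cite: CremonaAlgorithms1997, Table 1 (N = 17, torsion of 17a1)] -/
theorem hasRationalTwoTorsionX_cremona17a1 : HasRationalTwoTorsionX cremona17a1 (11 / 4) := by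
  refine ⟨-15 / 8, ?_, by norm_num [cremona17a1]⟩
  rw [WeierstrassCurve.Affine.equation_iff]
  norm_num [cremona17a1]

/-- `17a2` has the rational points `(−1, 0)` and `(3, −2)` of order `2` (and `(−5/4, 1/8)`: full rational `2`-torsion).
[cite: CremonaAlgorithms1997, Table 1 (N = 17, torsion of 17a2)] -/
theorem hasRationalTwoTorsionX_cremona17a2 :
    HasRationalTwoTorsionX cremona17a2 (-1) ∧ HasRationalTwoTorsionX cremona17a2 3 := by
  refine ⟨⟨0, ?_, by norm_num [cremona17a2]⟩, ⟨-2, ?_, by norm_num [cremona17a2]⟩⟩ <;>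
  · rw [WeierstrassCurve.Affine.equation_iff]; norm_num [cremona17a2]

/-- `17a3` has the rational point `(−21/4, 17/8)` of order `2`. [cite: CremonaAlgorithms1997, Table 1 (N = 17, torsion of 17a3)] -/
theorem hasRationalTwoTorsionX_cremona17a3 : HasRationalTwoTorsionX cremona17a3 (-21 / 4) := by
  refine ⟨17 / 8, ?_, by norm_num [cremona17a3]⟩
  rw [WeierstrassCurve.Affine.equation_iff]
  norm_num [cremona17a3]

/-- `17a4` has the rational point `(1, −1)` of order `2`. [cite: CremonaAlgorithms1997, Table 1 (N = 17, torsion of 17a4)] -/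
theorem hasRationalTwoTorsionX_cremona17a4 : HasRationalTwoTorsionX cremona17a4 1 := by
  refine ⟨-1, ?_, by norm_num [cremona17a4]⟩
  rw [WeierstrassCurve.Affine.equation_iff]
  norm_num [cremona17a4]

/-- **The elliptic curves of conductor `17` (Cremona 1997, Table 1, `N = 17`; complete by the modularity of
semistable curves, Wiles 1995; for curves with a rational point of order `2` already Mazur 1977, III §7: «either
`N = 17` and `E` is isogenous to `X₀(17)`, or it is a Neumann–Setzer curve»):** every elliptic curve over `ℚ` of
conductor `17` is `ℚ`-isomorphic to one of the four curves `17a1`, `17a2`, `17a3`, `17a4` (the isogeny class of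
`X₀(17) = 17a1`). Named fact (`def … : Prop`): Cremona's modular-symbol computation at level `17`, the isogeny
class computation and the modularity theorem are not in the tree.
[cite: CremonaAlgorithms1997, Table 1 (N = 17: curves 17a1–17a4)] [cite: Wiles1995, Thm. 0.4 (semistable modularity)]
[cite: Mazur1977, III §7 (p. 162: "either N = 17 and E is isogenous to X₀(17), or it is a Neumann–Setzer curve")] -/
def Cremona1997_conductor_seventeen_classification : Prop :=
  ∀ (W : WeierstrassCurve ℚ) [W.IsElliptic], W.conductorNorm ℤ = 17 →
    ∃ C : WeierstrassCurve.VariableChange ℚ,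
      C • W = cremona17a1 ∨ C • W = cremona17a2 ∨ C • W = cremona17a3 ∨ C • W = cremona17a4

/-- The classification with the four models spelled out as coefficient vectors (the form consumed by
`…Theorems.DepletionAtTwo.not_prop514_of_conductor_seventeen`). [cite: CremonaAlgorithms1997, Table 1 (N = 17: curves 17a1–17a4)] -/
theorem Cremona1997_conductor_seventeen_classification.literal
    (h : Cremona1997_conductor_seventeen_classification) (W : WeierstrassCurve ℚ) [W.IsElliptic]
    (hN : W.conductorNorm ℤ = 17) :
    ∃ C : WeierstrassCurve.VariableChange ℚ,
      C • W = (⟨1, -1, 1, -1, -14⟩ : WeierstrassCurve ℚ) ∨ C • W = (⟨1, -1, 1, -6, -4⟩ : WeierstrassCurve ℚ) ∨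
        C • W = (⟨1, -1, 1, -91, -310⟩ : WeierstrassCurve ℚ) ∨ C • W = (⟨1, -1, 1, -1, 0⟩ : WeierstrassCurve ℚ) :=
  h W hN

end Literature.NumberTheory.EllipticCurves

end
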